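import Summits.QuantumAdvantage.AdviceFreeQNC0.AffBells35WRELQuiet

/-!
# qa-qnc0-p1 g35 — `PolyLossOfWREL` and the wired-elimination line, part 4/7: `TypicalMass` from the landed thin-tail bound; the unconditional line `(NP₁) ⟸ WiredElimination` (DualSZ in the tree)

Continuation of `AffBells35WRELQuiet`.

Ported to the tree VERBATIM (split into seven files `AffBells35PolyLossOfWREL` / `AffBells35WREL{Firing,Quiet,Typical,Structure,Twins,Toggle}` for the 400-line rule; lint fixes only: `push Not`, `card_filter_add_card_filter_not`, unused simp arguments, two `_`-binders) by the prover seat qn-prover-3 g20 at the ask of planner qa-qnc0-p1 g36 (INBOX 11:15Z: exp35/WREL35.lean FROZEN, 1891 l., farm rc 0 / 0 sorry); authored and proved by the planner seat qa-qnc0-p1 g35.  Serves the crux stmt-QuantumAdvantage-22907 (route DWalkThree); untagged (the gate refuses `--supports` across sub-problems on AdviceFreeQNC0/ targets).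
-/

noncomputable section
open Classical

namespace Summit.QuantumAdvantage.AdviceFreeQNC0.AffBells35

open Finset Literature.Computability.QuantumComplexity Literature.Computability.QuantumComplexity.RingHLF
open AffBells23 Fib19 AffBells26 AffBells29

variable {N : ℕ}

/-! ### `TypicalMass` PROVED from the landed thin-tail bound `AffBells29lit.thinTail` (ROUND-34 §12.12(u)). -/

section TM

/-- `exists_isOdd_three` (planner qa-qnc0-p1 g35, exp35/WREL35.lean; see the section header above). -/
theorem exists_isOdd_three : ∃ x : Fin 3 → Bool, IsOdd x :=
  ⟨![false, true, true], by rw [Fib19.isOdd_iff]; decide⟩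

/-- `thinTail` with the signs of its constants made explicit (`0 < κ < 1`, `0 < C`). -/
theorem thinTail_pos : ∃ κ : ℝ, 0 < κ ∧ κ < 1 ∧ ∃ C : ℝ, 0 < C ∧ ∀ n ≥ 3, ∀ (D : Finset (Fin n)) (t : ℕ),
    (((univ.filter fun x : Fin n → Bool =>
        IsOdd x ∧ (D.filter fun i => kline x i = false).card ≤ t).card : ℕ) : ℝ)
      ≤ (2 : ℝ) ^ t * (C * κ ^ D.card * (2 : ℝ) ^ (n - 1)) := by
  obtain ⟨κ, hκ1, C, hC⟩ := AffBells29lit.thinTail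
  obtain ⟨x₀, hx₀⟩ := exists_isOdd_three
  have h0 := hC 3 le_rfl ∅ 0
  have h3 := hC 3 le_rfl univ 3
  set S0 := (univ.filter fun x : Fin 3 → Bool =>
      IsOdd x ∧ ((∅ : Finset (Fin 3)).filter fun i => kline x i = false).card ≤ 0) with hS0
  set S3 := (univ.filter fun x : Fin 3 → Bool =>
      IsOdd x ∧ ((univ : Finset (Fin 3)).filter fun i => kline x i = false).card ≤ 3) with hS3
  have hc0 : (1 : ℝ) ≤ (S0.card : ℝ) := by
    have : 0 < S0.card := by
      rw [hS0]; exact card_pos.2 ⟨x₀, mem_filter.2 ⟨mem_univ _, hx₀, by simp⟩⟩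
    exact_mod_cast this
  have hc3 : (1 : ℝ) ≤ (S3.card : ℝ) := by
    have : 0 < S3.card := by
      rw [hS3]; exact card_pos.2 ⟨x₀, mem_filter.2 ⟨mem_univ _, hx₀, le_trans (card_filter_le _ _) (by simp)⟩⟩
    exact_mod_cast this
  simp only [card_empty, pow_zero, one_mul, mul_one, card_univ, Fintype.card_fin] at h0 h3
  norm_num at h0 h3
  have hCpos : 0 < C := by linarith
  have hk3 : 0 < κ ^ 3 := by nlinarith
  have hκpos : 0 < κ := by
    by_contra h
    push Not at h
    have : κ ^ 3 ≤ 0 := by nlinarith [sq_nonneg κ]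
    linarith
  exact ⟨κ, hκpos, hκ1, C, hCpos, hC⟩

/-- `coinDist_eq_filter` (planner qa-qnc0-p1 g35, exp35/WREL35.lean; see the section header above). -/
theorem coinDist_eq_filter (β : Fin N → Fin N → ZMod 3) (x : Fin N → Bool) (v w : Fin N → ZMod 3) :
    coinDist β x v w = ((univ.filter fun i => v i ≠ w i).filter fun i => kline x i = false).card := by
  unfold coinDist
  congr 1
  ext i
  simp only [mem_filter, mem_univ, true_and]
  tauto

/-- **P-38am PROVED.** -/
theorem typicalMass : TypicalMass := by
  intro e
  obtain ⟨κ, hκ0, hκ1, C, hC0, hC⟩ := thinTail_pos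
  obtain ⟨k, hk⟩ := exists_pow_lt_of_lt_one (show (0 : ℝ) < 1 / 2 by norm_num) hκ1
  refine ⟨k * (e + 12), k * (e + 12), max 3 (Nat.ceil (3 * C * 2 ^ (e + 27))), fun N hN β => ?_⟩
  have hN3 : 3 ≤ N := le_trans (le_max_left _ _) hN
  have hNceil : (3 * C * 2 ^ (e + 27) : ℝ) ≤ N :=
    le_trans (Nat.le_ceil _) (by exact_mod_cast le_trans (le_max_right _ _) hN)
  set L := Nat.log 2 N with hL
  set R := k * (e + 12) * L with hR
  set t := dScale N - 1 with ht
  have htD : dScale N = t + 1 := by rw [ht]; unfold dScale; omega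
  -- the event sets and their individual bounds
  set E : Finset (Fin N) → Finset (Fin N → Bool) :=
    fun D => univ.filter fun x => IsOdd x ∧ (D.filter fun i => kline x i = false).card ≤ t with hEdef
  set B : ℝ := (2 : ℝ) ^ t * (C * κ ^ R * (2 : ℝ) ^ (N - 1)) with hB
  have hBnn : 0 ≤ B := by positivity
  have hE : ∀ D : Finset (Fin N), R ≤ D.card → ((E D).card : ℝ) ≤ B := by
    intro D hD
    refine le_trans (hC N hN3 D t) ?_
    have h1 : κ ^ D.card ≤ κ ^ R := pow_le_pow_of_le_one hκ0.le hκ1.le hD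
    have h2 : C * κ ^ D.card * (2 : ℝ) ^ (N - 1) ≤ C * κ ^ R * (2 : ℝ) ^ (N - 1) :=
      mul_le_mul_of_nonneg_right (mul_le_mul_of_nonneg_left h1 hC0.le) (by positivity)
    exact mul_le_mul_of_nonneg_left h2 (by positivity)
  -- covering the atypical inputs by events with `|D| ≥ R`
  set pairs : Finset (Fin N × Fin N) := univ.filter fun p => ¬ NearRows R β p.1 p.2 with hpairs
  set rows : Finset (Fin N) := univ.filter fun g => R ≤ (rowSupp β g).card with hrows
  have hcover : atypical R (dScale N) R β ⊆
      pairs.biUnion (fun p => E (univ.filter fun i => β p.1 i ≠ β p.2 i)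
          ∪ E (univ.filter fun i => β p.1 i ≠ 2 * β p.2 i))
        ∪ rows.biUnion (fun g => E (rowSupp β g)) := by
    intro x hx
    obtain ⟨hodd, hnt⟩ := (mem_filter.1 hx).2
    by_contra hcon
    rw [mem_union, not_or, mem_biUnion, mem_biUnion, not_exists, not_exists] at hcon
    obtain ⟨hc1, hc2⟩ := hcon
    apply hnt
    constructor
    · intro g h hnn
      have hp : (g, h) ∈ pairs := mem_filter.2 ⟨mem_univ _, hnn⟩
      have hgh := hc1 (g, h)
      rw [not_and, mem_union, not_or] at hgh
      obtain ⟨hA, hB'⟩ := hgh hp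
      dsimp only at hA hB'
      constructor
      · rw [htD, coinDist_eq_filter]
        by_contra hlt
        exact hA (mem_filter.2 ⟨mem_univ _, hodd, by omega⟩)
      · rw [htD, coinDist_eq_filter]
        by_contra hlt
        exact hB' (mem_filter.2 ⟨mem_univ _, hodd, by omega⟩)
    · intro g hW
      have hg : g ∈ rows := mem_filter.2 ⟨mem_univ _, hW⟩
      have hgg := hc2 g
      rw [not_and] at hgg
      have hA := hgg hg
      rw [htD, coinDist_eq_filter]
      by_contra hlt
      refine hA (mem_filter.2 ⟨mem_univ _, hodd, ?_⟩)
      have : (univ.filter fun i => β g i ≠ (fun _ : Fin N => (0 : ZMod 3)) i) = rowSupp β g := by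
        ext i; simp [rowSupp]
      rw [this] at hlt
      omega
  -- counting
  have hpairs_card : (pairs.card : ℝ) ≤ (N : ℝ) ^ 2 := by
    have : pairs.card ≤ N ^ 2 := by
      calc pairs.card ≤ (univ : Finset (Fin N × Fin N)).card := card_filter_le _ _
        _ = N ^ 2 := by rw [card_univ, Fintype.card_prod, Fintype.card_fin]; ring
    exact_mod_cast this
  have hrows_card : (rows.card : ℝ) ≤ (N : ℝ) := by
    have : rows.card ≤ N := by
      calc rows.card ≤ (univ : Finset (Fin N)).card := card_filter_le _ _
        _ = N := by rw [card_univ, Fintype.card_fin]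
    exact_mod_cast this
  have hsize1 : ∀ p ∈ pairs, R ≤ (univ.filter fun i => β p.1 i ≠ β p.2 i).card ∧
      R ≤ (univ.filter fun i => β p.1 i ≠ 2 * β p.2 i).card := by
    intro p hp
    have hnn := (mem_filter.1 hp).2
    unfold NearRows at hnn
    push Not at hnn
    exact hnn
  have hcard : ((atypical R (dScale N) R β).card : ℝ) ≤ 3 * (N : ℝ) ^ 2 * B := by
    have step1 : (atypical R (dScale N) R β).card
        ≤ (∑ p ∈ pairs, ((E (univ.filter fun i => β p.1 i ≠ β p.2 i)).card
              + (E (univ.filter fun i => β p.1 i ≠ 2 * β p.2 i)).card))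
          + ∑ g ∈ rows, (E (rowSupp β g)).card := by
      refine le_trans (card_le_card hcover) (le_trans (card_union_le _ _) (add_le_add ?_ ?_))
      · refine le_trans card_biUnion_le (sum_le_sum fun p _ => card_union_le _ _)
      · exact card_biUnion_le
    have step1R : ((atypical R (dScale N) R β).card : ℝ)
        ≤ (∑ p ∈ pairs, (((E (univ.filter fun i => β p.1 i ≠ β p.2 i)).card : ℝ)
              + ((E (univ.filter fun i => β p.1 i ≠ 2 * β p.2 i)).card : ℝ)))
          + ∑ g ∈ rows, ((E (rowSupp β g)).card : ℝ) := by
      exact_mod_cast step1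
    refine le_trans step1R ?_
    have hsum1 : (∑ p ∈ pairs, (((E (univ.filter fun i => β p.1 i ≠ β p.2 i)).card : ℝ)
              + ((E (univ.filter fun i => β p.1 i ≠ 2 * β p.2 i)).card : ℝ))) ≤ ∑ p ∈ pairs, (B + B) :=
      sum_le_sum fun p hp => add_le_add (hE _ (hsize1 p hp).1) (hE _ (hsize1 p hp).2)
    have hsum2 : (∑ g ∈ rows, ((E (rowSupp β g)).card : ℝ)) ≤ ∑ g ∈ rows, B :=
      sum_le_sum fun g hg => hE _ (mem_filter.1 hg).2
    rw [sum_const, nsmul_eq_mul] at hsum1 hsum2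
    have hN1 : (1 : ℝ) ≤ N := by exact_mod_cast (by omega : 1 ≤ N)
    nlinarith [hsum1, hsum2, hpairs_card, hrows_card, hBnn, mul_nonneg (sub_nonneg.2 hpairs_card) hBnn,
      mul_nonneg (sub_nonneg.2 hrows_card) hBnn]
  -- arithmetic
  have hL1 : (2 : ℝ) ^ L ≤ N := by exact_mod_cast Nat.pow_log_le_self 2 (by omega : N ≠ 0)
  have hL2 : (N : ℝ) < 2 ^ (L + 1) := by exact_mod_cast Nat.lt_pow_succ_log_self one_lt_two N
  have hκR : κ ^ R * (N : ℝ) ^ (e + 12) ≤ 2 ^ (e + 12) := by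
    have h1 : κ ^ R ≤ (1 / 2 : ℝ) ^ ((e + 12) * L) := by
      rw [hR, show k * (e + 12) * L = k * ((e + 12) * L) by ring, pow_mul]
      exact pow_le_pow_left₀ (by positivity) hk.le _
    have h2 : (N : ℝ) ^ (e + 12) ≤ ((2 : ℝ) ^ (L + 1)) ^ (e + 12) := pow_le_pow_left₀ (by positivity) hL2.le _
    calc κ ^ R * (N : ℝ) ^ (e + 12) ≤ (1 / 2 : ℝ) ^ ((e + 12) * L) * ((2 : ℝ) ^ (L + 1)) ^ (e + 12) :=
          mul_le_mul h1 h2 (by positivity) (by positivity)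
      _ = 2 ^ (e + 12) := by
          rw [← pow_mul, show (L + 1) * (e + 12) = (e + 12) * L + (e + 12) by ring, pow_add, ← mul_assoc,
            ← mul_pow]
          norm_num
  have h2t : (2 : ℝ) ^ t ≤ 2 ^ 15 * (N : ℝ) ^ 4 := by
    have : t = L * 4 + 15 := by rw [ht]; unfold dScale; omega
    rw [this, pow_add, pow_mul]
    have : ((2 : ℝ) ^ L) ^ 4 ≤ (N : ℝ) ^ 4 := pow_le_pow_left₀ (by positivity) hL1 4
    nlinarith
  have hNpos : (0 : ℝ) < N := by exact_mod_cast (by omega : 0 < N)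
  have hfin : ((atypical R (dScale N) R β).card : ℝ) * (N : ℝ) ^ (e + 2) ≤ 2 ^ (N - 1) := by
    have hN8 : (0 : ℝ) < (N : ℝ) ^ 8 := by positivity
    refine le_of_mul_le_mul_right ?_ hN8
    have hN5 : (N : ℝ) * (N : ℝ) ^ 4 ≤ (N : ℝ) ^ 8 := by
      rw [← pow_succ']
      exact pow_le_pow_right₀ (by exact_mod_cast (by omega : 1 ≤ N)) (by norm_num)
    calc ((atypical R (dScale N) R β).card : ℝ) * (N : ℝ) ^ (e + 2) * (N : ℝ) ^ 8
        ≤ 3 * (N : ℝ) ^ 2 * B * (N : ℝ) ^ (e + 2) * (N : ℝ) ^ 8 := by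
          have : (0 : ℝ) ≤ (N : ℝ) ^ (e + 2) * (N : ℝ) ^ 8 := by positivity
          nlinarith [hcard]
      _ = 3 * C * 2 ^ (N - 1) * (2 : ℝ) ^ t * (κ ^ R * (N : ℝ) ^ (e + 12)) := by rw [hB]; ring
      _ ≤ 3 * C * 2 ^ (N - 1) * (2 ^ 15 * (N : ℝ) ^ 4) * 2 ^ (e + 12) := by
          have ha : 0 ≤ 3 * C * (2 : ℝ) ^ (N - 1) := by positivity
          have hb : 0 ≤ κ ^ R * (N : ℝ) ^ (e + 12) := by positivity
          calc 3 * C * 2 ^ (N - 1) * (2 : ℝ) ^ t * (κ ^ R * (N : ℝ) ^ (e + 12))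
              ≤ 3 * C * 2 ^ (N - 1) * (2 ^ 15 * (N : ℝ) ^ 4) * (κ ^ R * (N : ℝ) ^ (e + 12)) :=
                mul_le_mul_of_nonneg_right (mul_le_mul_of_nonneg_left h2t ha) hb
            _ ≤ 3 * C * 2 ^ (N - 1) * (2 ^ 15 * (N : ℝ) ^ 4) * 2 ^ (e + 12) :=
                mul_le_mul_of_nonneg_left hκR (by positivity)
      _ = (3 * C * 2 ^ (e + 27)) * ((N : ℝ) ^ 4 * 2 ^ (N - 1)) := by ring
      _ ≤ (N : ℝ) * ((N : ℝ) ^ 4 * 2 ^ (N - 1)) := mul_le_mul_of_nonneg_right hNceil (by positivity)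
      _ = ((N : ℝ) * (N : ℝ) ^ 4) * 2 ^ (N - 1) := by ring
      _ ≤ (N : ℝ) ^ 8 * 2 ^ (N - 1) := mul_le_mul_of_nonneg_right hN5 (by positivity)
      _ = 2 ^ (N - 1) * (N : ℝ) ^ 8 := by ring
  exact_mod_cast hfin

/-- **So `ComponentElimination` HOLDS outright** (given the proved `DualSZDecoupling`), and the (NP₁) line has ONE open statement:
`DualSZDecoupling → WiredElimination → AffBellsPolyLoss3`. -/
theorem polyLoss_of_wired (h₀ : DualSZDecoupling) (h₃ : WiredElimination) : AffBellsPolyLoss3 :=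
  polyLoss_of_dualSZ h₀ typicalMass h₃

/-- `componentElimination_of_dualSZ` (planner qa-qnc0-p1 g35, exp35/WREL35.lean; see the section header above). -/
theorem componentElimination_of_dualSZ (h₀ : DualSZDecoupling) : ComponentElimination :=
  ce_of_silenceMass (silenceMass_of_typical typicalMass (tpq_of_dualSZ h₀))

end TM




/-! ### The dual Schwartz–Zippel decoupling is IN THE TREE (p711703, `DualGridSZ.dualSZDecoupling`, with the weaker
hypothesis `4(m+1)²(z+1)² < 2^D`), so `DualSZDecoupling`, `TypicalPerfectQuiet`, `ComponentSilenceMass` and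
`ComponentElimination` all HOLD, and the (NP₁) line is reduced to the single statement `WiredElimination`. -/

section Unconditional

open Literature.Computability.MetaComplexity in
/-- `dualSZDecoupling_holds` (planner qa-qnc0-p1 g35, exp35/WREL35.lean; see the section header above). -/
theorem dualSZDecoupling_holds : DualSZDecoupling := by
  intro F _ _ ω hω z m D a w ε Q κ hD hwide hsep hκ
  exact DualGridSZ.dualSZDecoupling F ω hω z m D a w ε Q κ
    ((Nat.mul_le_mul_right _ (Nat.mul_le_mul_right _ (by norm_num))).trans_lt hD) hwide hsep hκ

/-- `typicalPerfectQuiet_holds` (planner qa-qnc0-p1 g35, exp35/WREL35.lean; see the section header above). -/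
theorem typicalPerfectQuiet_holds : TypicalPerfectQuiet := tpq_of_dualSZ dualSZDecoupling_holds

/-- `componentElimination_holds` (planner qa-qnc0-p1 g35, exp35/WREL35.lean; see the section header above). -/
theorem componentElimination_holds : ComponentElimination :=
  componentElimination_of_dualSZ dualSZDecoupling_holds

/-- **(NP₁) ⟸ `WiredElimination`** — the whole polynomial-loss line for `q = 3` now rests on ONE typed statement
(P-38ak′, ROUND-34 §12.12(t)): wide rows lying in a *wired* component (one containing a narrow row within the
`O(log N)` near-row radius) can be eliminated at cost `≤ |imperfect|·o(1) + 2^{N-1}/N^{e+2}`. -/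
theorem polyLoss_of_wiredElimination (h : WiredElimination) : AffBellsPolyLoss3 :=
  polyLoss_of_wired dualSZDecoupling_holds h

/-- and a fortiori from the structural `NoWires`. -/
theorem polyLoss_of_noWires (h : NoWires) : AffBellsPolyLoss3 :=
  polyLoss_of_wiredElimination (noWires_imp_wired h)

end Unconditional

end Summit.QuantumAdvantage.AdviceFreeQNC0.AffBells35
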